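import Summits.BirchSwinnertonDyer.BirchSwinnertonDyer.Theorems.TwoAdicConverseOrdLambdaHalfAtTwoBDPTwoVariableDefs
import Summits.BirchSwinnertonDyer.BirchSwinnertonDyer.Theorems.TwoAdicConverseBDPSelmerLowerDivisibilityAtTwoPrimePinning
import HarnessLib

/-!
# Disproof of `BDPSelmerLowerDivisibilityAtTwo` (O2, stmt-BirchSwinnertonDyer-24728) — findings of the standing disprover (u1′ g0)

Crux: `Summit.BirchSwinnertonDyer.BirchSwinnertonDyer.Theorems.TwoAdicKatoDeterminant.BDPSelmerLowerDivisibilityAtTwo`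
(route `TwoAdicConverse`, rung S3; line of record `Cruxes/OrdLambdaHalfAtTwo/Lines/kato_determinant_greenberg_two_O2_gv_squeeze_v4.lean`
v9.2, node `O2 ⟸ P0 ∧ PIN ∧ CONTENT ∧ U ∧ R0T ∧ ACPIN`, kernel pieces P0/PIN/CONTENT/S, research stubs U = `stub_upperInclusionRat`,
R0G = `stub_greenbergFunctionFree`, ACPIN = `stub_acFibrePinning`, print stub OV16).

VERDICT OF THIS PASS: **no kill.**  O2 is not junk-refutable in the kernel and no instrument reading of the cell contradicts it.
What this file DOES contain is kernel-checked (sorry-free) LOAD-BEARING ANALYSIS of the squeeze seam through which U, R0G and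
ACPIN are consumed, refutations of the natural strengthenings a prover might be tempted to use, and the named conjectural
negations (as `Prop`s, no axioms, no sorries) that a later seat can try to inhabit.

## Findings (each a theorem below unless marked REMARK)

§2 Seam S (`GaussRigidity₂`, kernel p766427) — what is load-bearing:
* `gaussRigidity₂_false_without_residue` — drop `red₂ C ≠ 0` (the RESIDUE half of TORSION ∧ RESIDUE, i.e. algebraic `μ = 0`
  of the generator): FALSE.  Witness `C = 2, G = 4, h = 2, m = 0` (`4 ∤ 2` in `𝒪_{ℂ₂}`).  So every road through S must
  deliver `μ(ch X_Gr₂) = 0` in residue currency (CONTENT does: `J C₀ = 2^a C₁`, `red C₁ ≠ 0`; the `2^a` then rides in U's slack).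
* `not_gaussRigidity₂WithSlack` — REFUTED STRENGTHENING: replace the slack `2^m` by an arbitrary non-zero `s ∈ A₂` (even one
  with `red₂ s ≠ 0`, even `s` in the one-variable subring): FALSE.  Witness `C = s = T + 2`, `G = h = T + 4` (`T` the outer
  variable): `s·G = C·h`, `red C = red G = T`, but `(T+4) ∤ (T+2)` (constant terms: `4 ∤ 2`).  CONSEQUENCE FOR U: the printed
  rational currency of BSTW 9.24 / Yan–Zhu 4.6 («`ch · h(T₁) ⊆ (𝓛)` for some non-zero `h`», or `⊗ ℚ` with a non-constant
  correction factor) CANNOT feed the squeeze; U must be typed with CONSTANT slack (`2^m`, as it is) — a U landed with a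
  non-constant Euler-factor/`h(T₁)` slack does not close O2 through this node.  (REMARK: constant non-2-power slack `c ∈ 𝒪∖0`
  is fine — Gauss content for constants, `C_C_dvd_of_C_C_dvd_mul_of_exists_isUnit_coeff`.)
* `not_gaussRigidity₂LowerResidual` — REFUTED STRENGTHENING: weaken `(red G) = (red C)` to the LOWER residual divisibility
  `red G ∈ (red C)` (which U + CONTENT give for free): FALSE.  Witness `C = h = T`, `G = T²`, `m = 0`.  The UPPER residual
  divisibility `red C ∈ (red G)` alone suffices (that is PIN at `𝔓 = ⊥`, kernel) — so the ENTIRE research content that ACPIN /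
  RresEq must supply at the seam is `red₂ G ∣ red₂ C₁` (two-variable) or its one-line proxy (N)+(Λ).

§3 PIN (`PrimePinning₂`, kernel p768124) — what is load-bearing:
* `primePinning₂_false_without_N` — drop (N) `red₂ G ∉ 𝔓` (`μ = 0` of `G` ALONG the line `𝔓`): FALSE.  Witness `C₁ = h = T`,
  `G = T²`, `a = m = 0`, `𝔓 = (T)` (prime).  So TEST-μ's reading `μ(G|_ac) = 0` (ADD-6: read ×6) is exactly the load-bearing
  analytic input; it is NOT implied by the other hypotheses.
* `primePinning₂_false_without_Λ` — drop (Λ) `red₂ C₁ ∈ 𝔓 ⊔ (red₂ G)`: FALSE.  Same witness with `𝔓 = ⊥`.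
* `span_le_span_of_pin_anyIdeal` — MUTATION, positive: the hypothesis `𝔓.IsPrime` of PIN is DECORATION.  PIN holds for EVERY
  ideal `𝔓` of `𝔽̄₂⟦T₁,T₂⟧` (proof: if `1 − q·red h₀` is a unit then `red G ∈ 𝔓`, contradiction; else `q·red h₀` is a unit of
  the local ring).  Hence ACPIN's `∃ 𝔓 prime` may be read `∃ 𝔓 ideal`; and (REMARK) under U the pinning hypotheses at ANY `𝔓`
  force `G = C₁·unit`, i.e. the two-variable residual span equality `(red G) = (red C₁)` — ACPIN ∧ U and RresEq ∧ U coincide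
  pointwise; the resplit relocates the research (one line instead of two variables), it does not weaken the conclusion drawn.

§4 Targets R0G / U (director (738)(3)(a),(b)) — no kernel obstruction is reachable; recorded as named `Prop`s + census:
* No `_false_without_<H>` theorem for R0G or U themselves can be kernel-checked today: every such statement is a `∀` over the
  habitat datum `(W, K, ι, v, v̄, κ₁, κ₂, γ₁, γ₂, f)` and NO datum is constructible in the tree (no `PadicAlgCl 2 ≃+* ℂ`, no
  newform `f` with `IsNewformOf W f`, no adapted `ZpExtension` pair with its `Fact`, no in-range Hecke character with a `2`-adic
  avatar, CM theta and entire Rankin–Selberg `L`).  With `Ω = 0` admitted (drop `Ω ≠ 0`) the frame is satisfied by `LK = G = 0`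
  — not a refutation either.  The honest shape is `H → ¬ D` with `H` = existence of a datum; seat 1's
  `Lines/greenberg_value_blowup_two.lean` (`GreenbergValueBlowupTwo.not_bdpSelmerLowerDivisibilityAtTwo_of_blowup`) IS that road
  for the value frame (`H` = a datum and an in-range `ξ` with `‖V(ξ)‖ > 1`); this pass adds nothing to it because the instrument
  record contains NO blow-up witness (below).
* REMARK (mutation of R0G): the Katz hypotheses on `LK` (`IsKatzMeasure₂ …`, `Ω ≠ 0`, `δ² = ±D_K`) are plausibly NOT load-bearing
  for R0G: `IsGreenbergLFunctionFree₂ … LK G` prescribes `G(pt ξ) = h_K · LK(pt ξ^{1−τ}) · V(ξ)`, and `ξ ↦ ξ^{1−τ}` is a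
  power-series substitution on the weight space, so `G_{LK} := (LK ∘ φ) · G_1` serves every bounded `LK` once `G_1` serves
  `LK = 1`.  Hence R0G ⟺ «the two-variable BDP-type series `G_1` interpolating `h_K·V(ξ)` exists in `𝒪_{ℂ₂}⟦T₁,T₂⟧`» — the
  Katz datum is decoration for R0G (it is NOT for U / O2, where `LK` couples `G` to `ch X_Gr₂`).  Named below: `R0GKatzFree`.
* λ/μ witness attempt against R0G at 2 (director (b)): NONE AVAILABLE.  Cell instruments of record (audit-2 ADD-5/6/7):
  TEST-μ `μ(G|_ac) = 0` read at 6/6 data (1289a1, 1913b1, 233a1, 113a1, 869c1, 1507a1; K = ℚ(√−7)); RS-DIAGONAL / RSOFF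
  `v₂(Λ(ξ_{m,n})) = n − m + 1` at 22/22 frame points on the (β) pair, i.e. `v₂(V(ξ)) = 2` everywhere measured (113a1: `= 4` at
  6/6), floor met with margin exactly 2, `G(0,0) = 4·unit` (W⁺/W⁺) — so `‖V(ξ)‖ ≤ 2⁻² < 1` at every measured point: the blow-up
  hinge has NO witness; λ-LIKE readings `λ(G_ac) = 8, 16, 4, 4, 6, 6`; the ALGEBRAIC column (ADD-7 DESC2-ACLINE) is rank-exact
  (`corank Sel_{2^∞}(E/K_n^ac) = 2ⁿ + (0,0,0,2,2,2)`, n ≤ 4) but ORDER-BLIND at 2 — `m / a / k` and `λ(C₀|_ac)` are UNREAD, so no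
  comparison `λ_alg > λ_an` (the only shape of a λ-witness against U ∧ ACPIN) can be formed.  0 kit in this seat.
* Dead lines honoured (not re-proposed): V#42 (etale-eisenstein), V#105 / V#109 (rubin-value-two-native).
* Junk exits checked and closed (NOTES census): α-asymmetry of the type-II value (root-independence is a tree theorem
  `typeTwoInterpolationValueL_div`); vanishing `typeTwoDenominator` on the range (`(π/π̄)^{m+n+2} ≠ 1`); non-uniqueness of `G`
  (Jensen on each line ⇒ unique); vacuous value frame (`G := 1`) — range non-empty, neither side kernel-decidable;
  `Module.charIdeal` junk `⊤` off torsion makes U trivially true there, not false.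

LANDED (importable twin of §1–§3, theorems only, statements unfolded): proposal p803601 →
`Summits/BirchSwinnertonDyer/BirchSwinnertonDyer/Theorems/BDPSelmerLowerDivisibilityAtTwo/Negative/SqueezeSeamLoadBearing.lean`
(namespace `…Theorems.BDPSelmerLowerDivisibilityAtTwo.Negative.SqueezeSeam`).

## HANDOFF (for the next arm of this seat)
Landed under Negative/: p803601 (pending verdict at write time).  Sorried here: nothing.  Next regimes to try when a datum becomes
constructible: (1) `R0GKatzFree` at `LK = 1`; (2) seat 1's blow-up hinge at the first in-range `ξ` of `ℚ(√−7)` with `(m,n) = (1,1)`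
(ADD-5 reads `v₂ V = 2`, so expect NO blow-up — a consistency check, not a kill); (3) if the lead's HANDOFF lists STUCK stubs of
v9.x, attack their signatures with the §2/§3 witnesses (any stub consuming U with non-constant slack is dead on arrival).

Nothing about any elliptic curve is asserted; O2 stays OPEN; BSD is proved for no curve.  All theorems: axioms ⊆
{propext, Classical.choice, Quot.sound}.  References: [folklore] (Gauss's lemma over a rank-one valuation ring; local rings);
the line card `Cruxes/BDPSelmerLowerDivisibilityAtTwo/Lines/two_variable_gv_squeeze_two.md`; audit-2 `D-AUDIT-O2-NORM-dprime`
ADDENDUM-5/6/7 (cell `pub/bsd-2adic/audit/`).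
-/

-- D-0017: single-problem summit, the namespace repeats the problem name by design.
set_option linter.dupNamespace false
set_option autoImplicit false

noncomputable section

open scoped Classical

namespace Summit.BirchSwinnertonDyer.BirchSwinnertonDyer.Cruxes.BDPSelmerLowerDivisibilityAtTwo.Disproof

open PowerSeries Literature.NumberTheory.EllipticCurves
open Summit.BirchSwinnertonDyer.BirchSwinnertonDyer.Theorems
open Summit.BirchSwinnertonDyer.BirchSwinnertonDyer.Theorems.TwoAdicBDPGaussContent
open Summit.BirchSwinnertonDyer.BirchSwinnertonDyer.Theorems.TwoAdicBDPPrimePinning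

/-! ## §1 The rings of the seam (local copies of the line's `A₂`, `Ω₂`, `red₂`; Cruxes files are not importable) -/

/-- `𝒪_{ℂ₂}⟦T₁,T₂⟧` — home of `G`, `LK`, `toUnr₂ 2 J C₀`. -/
abbrev A₂ : Type := PowerSeries (PowerSeries (PadicComplexInt 2))

/-- The special fibre `𝔽̄₂⟦T₁,T₂⟧`. -/
abbrev Ω₂ : Type := PowerSeries (PowerSeries (IsLocalRing.ResidueField (PadicComplexInt 2)))

/-- Coefficientwise reduction modulo `𝔪_{𝒪_{ℂ₂}}` (character for character the line's `red₂`). -/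
def red₂ : A₂ →+* Ω₂ := PowerSeries.map (PowerSeries.map (IsLocalRing.residue (PadicComplexInt 2)))

/-- `red₂ 2 = 0` (the special fibre has characteristic `2`). [folklore] -/
theorem red₂_two : red₂ (2 : A₂) = 0 := by
  have h := map_map_residue_natCast_prime (p := 2)
  rw [Nat.cast_ofNat] at h
  exact h

/-- `red₂ T = T` for the outer variable. [folklore] -/
theorem red₂_X : red₂ (X : A₂) = X := by
  unfold red₂
  exact PowerSeries.map_X _

/-- `4 ∤ 2` in `𝒪_{ℂ₂}`: `2` is a non-zero non-unit of a domain. [folklore] -/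
theorem two_mul_two_not_dvd_two : ¬ ((2 : PadicComplexInt 2) * 2 ∣ 2) := by
  rintro ⟨q, hq⟩
  have h2 : (2 : PadicComplexInt 2) ≠ 0 := by
    have h := natCast_prime_padicComplexInt_ne_zero (p := 2)
    rwa [Nat.cast_ofNat] at h
  have hnu : ¬ IsUnit (2 : PadicComplexInt 2) := by
    have h := SignedBaseChangeK1RationalAnchor.not_isUnit_natCast_padicComplexInt (p := 2)
    rwa [Nat.cast_ofNat] at h
  have h1 : (2 : PadicComplexInt 2) * (2 * q) = 2 * 1 := by rw [mul_one, ← mul_assoc]; exact hq.symm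
  exact hnu (IsUnit.of_mul_eq_one q (mul_left_cancel₀ h2 h1))

/-- The augmentation `A₂ → 𝒪_{ℂ₂}`, `F ↦ F(0,0)`. -/
def aug : A₂ →+* PadicComplexInt 2 := PowerSeries.constantCoeff.comp PowerSeries.constantCoeff

/-- `T(0,0) = 0`. [folklore] -/
theorem aug_X : aug (X : A₂) = 0 := by
  simp [aug]

/-- `(T + 4) ∤ (T + 2)` in `A₂` (augment: `4 ∤ 2`). [folklore] -/
theorem X_add_four_not_dvd_X_add_two : ¬ ((X : A₂) + 2 * 2 ∣ X + 2) := by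
  intro h
  have h' := map_dvd aug h
  rw [map_add, map_add, map_mul, aug_X, zero_add, zero_add, map_ofNat] at h'
  exact two_mul_two_not_dvd_two h'

/-- `4 ∤ 2` in `A₂`. [folklore] -/
theorem four_not_dvd_two : ¬ ((2 : A₂) * 2 ∣ 2) := by
  intro h
  have h' := map_dvd aug h
  rw [map_mul, map_ofNat] at h'
  exact two_mul_two_not_dvd_two h'

/-- `T² ∤ T` in `A₂` (`T` is a non-zero non-unit of a domain). [folklore] -/
theorem X_sq_not_dvd_X : ¬ ((X : A₂) ^ 2 ∣ X) := by
  rintro ⟨q, hq⟩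
  have h1 : (X : A₂) * (X * q) = X * 1 := by rw [mul_one, ← mul_assoc, ← pow_two]; exact hq.symm
  have h2 : (X : A₂) * q = 1 := mul_left_cancel₀ X_ne_zero h1
  have h3 := congrArg PowerSeries.constantCoeff h2
  rw [map_mul, constantCoeff_X, zero_mul, map_one] at h3
  exact zero_ne_one h3

/-! ## §2 The seam S = `GaussRigidity₂` — load-bearing analysis and refuted strengthenings -/

/-- S with the RESIDUE hypothesis `red₂ C ≠ 0` DROPPED (everything else verbatim). -/
def GaussRigidity₂WithoutResidue : Prop :=
  ∀ (C G h : A₂) (m : ℕ), (2 : A₂) ^ m * G = C * h →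
    Ideal.span {red₂ G} = Ideal.span {red₂ C} → Ideal.span {C} ≤ Ideal.span {G}

/-- **Any proof through S must use `red₂ C ≠ 0` (algebraic `μ = 0` of the generator in residue currency).**
Witness `C = 2`, `G = 4`, `h = 2`, `m = 0`: `G = C·h`, `red C = red G = 0`, but `4 ∤ 2`. [folklore] -/
theorem gaussRigidity₂_false_without_residue : ¬ GaussRigidity₂WithoutResidue := by
  intro hS
  have h := hS 2 (2 * 2) 2 0 (by ring) (by rw [map_mul, red₂_two, mul_zero])
  exact four_not_dvd_two (Ideal.span_singleton_le_span_singleton.mp h)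

/-- S with the `2`-power slack `2^m` REPLACED by an arbitrary non-zero slack `s ∈ A₂` with non-zero reduction
(the «rational currency» of the printed two-variable divisibilities). -/
def GaussRigidity₂WithSlack : Prop :=
  ∀ (C G h s : A₂), s ≠ 0 → red₂ s ≠ 0 → s * G = C * h → red₂ C ≠ 0 →
    Ideal.span {red₂ G} = Ideal.span {red₂ C} → Ideal.span {C} ≤ Ideal.span {G}

/-- **REFUTED STRENGTHENING: the squeeze does not survive a non-constant slack.**  Witness `C = s = T + 2`,
`G = h = T + 4`: `s·G = C·h`, `red C = red G = red s = T ≠ 0`, but `(T + 4) ∤ (T + 2)`.  (The line card's CAUTION, now a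
theorem; the witness lives in the one-variable subring, so even a slack «`h(T₁) ≠ 0`» à la BSTW 9.24 is fatal.) [folklore] -/
theorem not_gaussRigidity₂WithSlack : ¬ GaussRigidity₂WithSlack := by
  intro hS
  have hC : red₂ ((X : A₂) + 2) = X := by rw [map_add, red₂_X, red₂_two, add_zero]
  have hG : red₂ ((X : A₂) + 2 * 2) = X := by rw [map_add, map_mul, red₂_X, red₂_two, mul_zero, add_zero]
  have hne : (X : A₂) + 2 ≠ 0 := fun h0 => by
    have h1 := congrArg red₂ h0
    rw [hC, map_zero] at h1
    exact X_ne_zero h1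
  have h := hS (X + 2) (X + 2 * 2) (X + 2 * 2) (X + 2) hne (by rw [hC]; exact X_ne_zero) (by ring)
    (by rw [hC]; exact X_ne_zero) (by rw [hC, hG])
  exact X_add_four_not_dvd_X_add_two (Ideal.span_singleton_le_span_singleton.mp h)

/-- S with the residual span EQUALITY weakened to the LOWER residual divisibility `red₂ G ∈ (red₂ C)`
(the half that U + CONTENT provide for free). -/
def GaussRigidity₂LowerResidual : Prop :=
  ∀ (C G h : A₂) (m : ℕ), (2 : A₂) ^ m * G = C * h → red₂ C ≠ 0 →
    red₂ G ∈ Ideal.span {red₂ C} → Ideal.span {C} ≤ Ideal.span {G}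

/-- **REFUTED STRENGTHENING: the lower residual divisibility is not enough** — the UPPER one `red₂ C ∈ (red₂ G)` is the
load-bearing half (and alone suffices: PIN at `𝔓 = ⊥`).  Witness `C = h = T`, `G = T²`, `m = 0`. [folklore] -/
theorem not_gaussRigidity₂LowerResidual : ¬ GaussRigidity₂LowerResidual := by
  intro hS
  have h := hS X (X ^ 2) X 0 (by ring) (by rw [red₂_X]; exact X_ne_zero)
    (by rw [map_pow, red₂_X, pow_two]; exact Ideal.mul_mem_left _ _ (Ideal.mem_span_singleton_self _))
  exact X_sq_not_dvd_X (Ideal.span_singleton_le_span_singleton.mp h)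

/-! ## §3 PIN = `PrimePinning₂` — load-bearing analysis ((N), (Λ) necessary; primality of `𝔓` unnecessary) -/

/-- PIN with (N) `red₂ G ∉ 𝔓` DROPPED. -/
def PrimePinning₂WithoutN : Prop :=
  ∀ (C₁ G h : A₂) (a m : ℕ) (𝔓 : Ideal Ω₂), 𝔓.IsPrime →
    (2 : A₂) ^ m * G = (2 : A₂) ^ a * C₁ * h → red₂ C₁ ≠ 0 →
    red₂ C₁ ∈ 𝔓 ⊔ Ideal.span {red₂ G} → Ideal.span {(2 : A₂) ^ a * C₁} ≤ Ideal.span {G}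

/-- **Any proof through PIN must use (N): `μ = 0` of `G` along the pinning line.**  Witness `C₁ = h = T`, `G = T²`,
`a = m = 0`, `𝔓 = (T)` (prime; `G` vanishes identically along it). [folklore] -/
theorem primePinning₂_false_without_N : ¬ PrimePinning₂WithoutN := by
  intro hP
  have h := hP X (X ^ 2) X 0 0 (Ideal.span {X}) PowerSeries.span_X_isPrime (by ring)
    (by rw [red₂_X]; exact X_ne_zero) (by rw [red₂_X]; exact Ideal.mem_sup_left (Ideal.mem_span_singleton_self _))
  rw [pow_zero, one_mul] at h
  exact X_sq_not_dvd_X (Ideal.span_singleton_le_span_singleton.mp h)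

/-- PIN with (Λ) `red₂ C₁ ∈ 𝔓 ⊔ (red₂ G)` DROPPED. -/
def PrimePinning₂WithoutΛ : Prop :=
  ∀ (C₁ G h : A₂) (a m : ℕ) (𝔓 : Ideal Ω₂), 𝔓.IsPrime →
    (2 : A₂) ^ m * G = (2 : A₂) ^ a * C₁ * h → red₂ C₁ ≠ 0 → red₂ G ∉ 𝔓 →
    Ideal.span {(2 : A₂) ^ a * C₁} ≤ Ideal.span {G}

/-- **Any proof through PIN must use (Λ).**  Witness `C₁ = h = T`, `G = T²`, `a = m = 0`, `𝔓 = ⊥`. [folklore] -/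
theorem primePinning₂_false_without_Λ : ¬ PrimePinning₂WithoutΛ := by
  intro hP
  have hN : red₂ ((X : A₂) ^ 2) ∉ (⊥ : Ideal Ω₂) := by
    rw [map_pow, red₂_X, Ideal.mem_bot]
    exact pow_ne_zero 2 X_ne_zero
  have h := hP X (X ^ 2) X 0 0 ⊥ Ideal.isPrime_bot (by ring) (by rw [red₂_X]; exact X_ne_zero) hN
  rw [pow_zero, one_mul] at h
  exact X_sq_not_dvd_X (Ideal.span_singleton_le_span_singleton.mp h)

/-- **MUTATION (positive): primality of `𝔓` is decoration in PIN — structure form.**  For EVERY ideal `𝔓` of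
`𝔽̄₂⟦T₁,T₂⟧`: `2^m·G = 2^a·C₁·h`, `red C₁ ≠ 0`, `red G ∉ 𝔓`, `red C₁ ∈ 𝔓 ⊔ (red G)` ⟹ `a ≤ m` and `G = C₁·u` for a UNIT `u`
of `A₂`.  Proof = the tree's (`TwoAdicBDPPrimePinning.span_le_span_of_prime_pin`) with the prime-avoidance step replaced by the
local-ring dichotomy: if `1 − q·red h₀` is a unit then `red G = (red G·(1 − q·red h₀))·(unit)⁻¹ ∈ 𝔓`, contradiction; else
`q·red h₀` is a unit. [folklore] -/
theorem le_and_exists_unit_of_pin_anyIdeal (C₁ G h : A₂) (a m : ℕ) (𝔓 : Ideal Ω₂)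
    (hGCh : (2 : A₂) ^ m * G = (2 : A₂) ^ a * C₁ * h) (hC₁ : red₂ C₁ ≠ 0) (hN : red₂ G ∉ 𝔓)
    (hΛ : red₂ C₁ ∈ 𝔓 ⊔ Ideal.span {red₂ G}) :
    a ≤ m ∧ ∃ u : A₂ˣ, G = C₁ * ↑u := by
  set P : A₂ := (2 : A₂) with hP
  have hP' : P = ((2 : ℕ) : A₂) := by rw [Nat.cast_ofNat]
  have hredP : red₂ P = 0 := red₂_two
  rcases Nat.lt_or_ge m a with hma | ham
  · -- `m < a`: `G = 2·(…)`, so `red G = 0 ∈ 𝔓`, contradicting (N)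
    obtain ⟨n, rfl⟩ : ∃ n, a = m + (n + 1) := ⟨a - m - 1, by omega⟩
    have hPm : P ^ m ≠ 0 := by rw [hP']; exact natCast_prime_pow_ne_zero (p := 2) m
    have h1 : G = P ^ (n + 1) * C₁ * h := by
      refine mul_left_cancel₀ hPm ?_
      rw [hGCh, pow_add]; ring
    have h0 : red₂ G = 0 := by
      rw [h1, map_mul, map_mul, map_pow, hredP, zero_pow (Nat.succ_ne_zero n), zero_mul, zero_mul]
    exact absurd (show red₂ G ∈ 𝔓 by rw [h0]; exact 𝔓.zero_mem) hN
  · -- `a ≤ m`: cancel `2^a`, Gauss content for the constant `2^(m-a)`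
    refine ⟨ham, ?_⟩
    obtain ⟨n, rfl⟩ := Nat.exists_eq_add_of_le ham
    have hPa : P ^ a ≠ 0 := by rw [hP']; exact natCast_prime_pow_ne_zero (p := 2) a
    have hPn : P ^ n ≠ 0 := by rw [hP']; exact natCast_prime_pow_ne_zero (p := 2) n
    have h1 : P ^ n * G = C₁ * h := by
      refine mul_left_cancel₀ hPa ?_
      rw [← mul_assoc, ← pow_add, hGCh, mul_assoc]
    have hC₁u : ∃ i : ℕ × ℕ, IsUnit (coeff i.2 (coeff i.1 C₁)) :=
      exists_isUnit_coeff_of_map_map_residue_ne_zero hC₁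
    have hdvd : PowerSeries.C (PowerSeries.C (((2 : ℕ) : PadicComplexInt 2) ^ n)) ∣ C₁ * h :=
      ⟨G, by rw [← h1, hP', natCast_pow_eq_C_C]⟩
    obtain ⟨h₀, rfl⟩ := C_C_dvd_of_C_C_dvd_mul_of_exists_isUnit_coeff hC₁u hdvd
    have hG : G = C₁ * h₀ := by
      refine mul_left_cancel₀ hPn ?_
      rw [h1, hP', natCast_pow_eq_C_C]; ring
    obtain ⟨t, ht, s, hs, hts⟩ := Submodule.mem_sup.mp hΛ
    obtain ⟨q, rfl⟩ := Ideal.mem_span_singleton'.mp hs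
    have hGred : red₂ G = red₂ C₁ * red₂ h₀ := by rw [hG, map_mul]
    have hkey : red₂ G * (1 - q * red₂ h₀) = t * red₂ h₀ := by
      have e : red₂ G = (t + q * red₂ G) * red₂ h₀ := by rw [hts]; exact hGred
      linear_combination e
    have hmem : red₂ G * (1 - q * red₂ h₀) ∈ 𝔓 := by
      rw [hkey]; exact 𝔓.mul_mem_right _ ht
    have hunit : IsUnit (q * red₂ h₀) := by
      rcases IsLocalRing.isUnit_or_isUnit_one_sub_self (q * red₂ h₀) with hu | hu
      · exact hu
      · exfalso
        refine hN ?_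
        have e : red₂ G = red₂ G * (1 - q * red₂ h₀) * ↑hu.unit⁻¹ := by
          rw [mul_assoc, IsUnit.mul_val_inv, mul_one]
        rw [e]
        exact 𝔓.mul_mem_right _ hmem
    obtain ⟨u, hu⟩ := isUnit_of_isUnit_map_map_residue (p := 2) (isUnit_of_mul_isUnit_right hunit)
    exact ⟨u, by rw [hu]; exact hG⟩

/-- **PIN for EVERY ideal `𝔓`** (no primality): `(2^a·C₁) ⊆ (G)`. [folklore] -/
theorem span_le_span_of_pin_anyIdeal (C₁ G h : A₂) (a m : ℕ) (𝔓 : Ideal Ω₂)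
    (hGCh : (2 : A₂) ^ m * G = (2 : A₂) ^ a * C₁ * h) (hC₁ : red₂ C₁ ≠ 0) (hN : red₂ G ∉ 𝔓)
    (hΛ : red₂ C₁ ∈ 𝔓 ⊔ Ideal.span {red₂ G}) :
    Ideal.span {(2 : A₂) ^ a * C₁} ≤ Ideal.span {G} := by
  obtain ⟨-, u, hu⟩ := le_and_exists_unit_of_pin_anyIdeal C₁ G h a m 𝔓 hGCh hC₁ hN hΛ
  exact Ideal.span_singleton_le_span_singleton.mpr
    ⟨↑u⁻¹ * (2 : A₂) ^ a, by rw [hu, mul_assoc, Units.mul_inv_cancel_left, mul_comm]⟩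

/-- PIN for every ideal, in the line's binder order (drop-in generalisation of `PrimePinning₂` without `𝔓.IsPrime`). -/
def PinAnyIdeal₂ : Prop :=
  ∀ (C₁ G h : A₂) (a m : ℕ) (𝔓 : Ideal Ω₂),
    (2 : A₂) ^ m * G = (2 : A₂) ^ a * C₁ * h → red₂ C₁ ≠ 0 → red₂ G ∉ 𝔓 →
    red₂ C₁ ∈ 𝔓 ⊔ Ideal.span {red₂ G} → Ideal.span {(2 : A₂) ^ a * C₁} ≤ Ideal.span {G}

/-- `PinAnyIdeal₂` holds (kernel). [folklore] -/
theorem pinAnyIdeal₂ : PinAnyIdeal₂ :=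
  fun C₁ G h a m 𝔓 h₁ h₂ h₃ h₄ => span_le_span_of_pin_anyIdeal C₁ G h a m 𝔓 h₁ h₂ h₃ h₄

/-- **Under the pinning hypotheses (at ANY ideal) the two-variable residual span equality already holds**:
`(red₂ G) = (red₂ C₁)` — ACPIN ∧ U and RresEq ∧ U draw the same conclusion at the seam. [folklore] -/
theorem residualSpanEq_of_pin (C₁ G h : A₂) (a m : ℕ) (𝔓 : Ideal Ω₂)
    (hGCh : (2 : A₂) ^ m * G = (2 : A₂) ^ a * C₁ * h) (hC₁ : red₂ C₁ ≠ 0) (hN : red₂ G ∉ 𝔓)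
    (hΛ : red₂ C₁ ∈ 𝔓 ⊔ Ideal.span {red₂ G}) :
    Ideal.span {red₂ G} = Ideal.span {red₂ C₁} := by
  obtain ⟨-, u, hu⟩ := le_and_exists_unit_of_pin_anyIdeal C₁ G h a m 𝔓 hGCh hC₁ hN hΛ
  have hu' : red₂ G = red₂ C₁ * red₂ (↑u : A₂) := by rw [hu, map_mul]
  refine le_antisymm (Ideal.span_singleton_le_span_singleton.mpr ⟨red₂ (↑u : A₂), hu'⟩)
    (Ideal.span_singleton_le_span_singleton.mpr ⟨red₂ (↑u⁻¹ : A₂), ?_⟩)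
  rw [hu', mul_assoc, ← map_mul, Units.mul_inv, map_one, mul_one]

/-- **The slack exponent of U dominates the content of the generator**: under the pinning hypotheses `a ≤ m`
(bookkeeping «`a ≤ m_U`» of audit-2 ADD-6 §A6.3, now a kernel one-liner). [folklore] -/
theorem content_le_slack_of_pin (C₁ G h : A₂) (a m : ℕ) (𝔓 : Ideal Ω₂)
    (hGCh : (2 : A₂) ^ m * G = (2 : A₂) ^ a * C₁ * h) (hC₁ : red₂ C₁ ≠ 0) (hN : red₂ G ∉ 𝔓)
    (hΛ : red₂ C₁ ∈ 𝔓 ⊔ Ideal.span {red₂ G}) : a ≤ m :=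
  (le_and_exists_unit_of_pin_anyIdeal C₁ G h a m 𝔓 hGCh hC₁ hN hΛ).1

/-! ## §4 Targets R0G / U — named conjectural `Prop`s (no axioms, no sorries; nothing asserted) -/

section Targets

open scoped NumberField
open WeierstrassCurve NumberField IsDedekindDomain Field CongruenceSubgroup
open Literature.NumberTheory.EllipticCurves.Rank1Residual Literature.NumberTheory.EllipticCurves.ModularForms
open Literature.NumberTheory.GaloisRepresentations
open Literature.NumberTheory.EllipticCurves.IwasawaAlgebra₂ Literature.NumberTheory.EllipticCurves.UnrSeries₂
open Literature.NumberTheory.EllipticCurves.YanZhu2026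

/-- **R0G, Katz-free** (mutation of `TwoVariableGreenbergObjectAtTwo`: the Katz datum `(Ω, δ, Ωp)` and `IsKatzMeasure₂ … LK`
DROPPED — `LK` ranges over all of `A₂`).  CONJECTURALLY EQUIVALENT to R0G (module docstring §4: `G_{LK} = (LK ∘ φ)·G_1`);
recorded so that a seat with a constructed datum can test the cheapest instance `LK = 1`.  Nothing asserted. -/
def R0GKatzFree : Prop :=
  ∀ (W : WeierstrassCurve ℚ) [W.IsElliptic] [W.IsGloballyMinimal],
    ¬ W.HasCM → GoodOrd W 2 → ¬ W.HasIrreducibleModPGaloisRep 2 →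
    ∀ (K : Type) [Field K] [NumberField K],
      (IsImaginaryQuadratic K ∧ SatisfiesHeegnerHypothesis (2 * W.conductorNorm ℤ) K) →
      ∀ [IsCMField K] (ι : PadicAlgCl 2 ≃+* ℂ) (v vbar : HeightOneSpectrum (𝓞 K))
        (κ₁ κ₂ : ZpExtension K 2) (γ₁ γ₂ : absoluteGaloisGroup K) [Fact (ZpExtension.IsTopGeneratorPair κ₁ κ₂ γ₁ γ₂)]
        [NeZero (W.conductorNorm ℤ)] (f : CuspForm (Gamma0 (W.conductorNorm ℤ)) 2),
        ModularForms.IsNewformOf W f → ∀ [NeZero (NumberField.discr K).natAbs],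
        ((2 : ℕ) : 𝓞 K) ∈ v.asIdeal → ((2 : ℕ) : 𝓞 K) ∈ vbar.asIdeal → vbar ≠ v →
        (∀ (w : InfinitePlace K) (k : 𝓞 K), k ∈ v.asIdeal ↔ ‖ι.symm (w.embedding (k : K))‖ < 1) →
        ∀ LK : A₂, ∃ G : A₂,
          IsGreenbergLFunctionFree₂ ι v vbar κ₁ κ₂ γ₁⁻¹ γ₂⁻¹ f (NumberField.discr K).natAbs (NumberField.classNumber K) LK G

/-- **The negation of O2, by name** — the target of this work file; NOT proved, NOT asserted.  The only road of record towards it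
is seat 1's hinge `GreenbergValueBlowupTwo.not_bdpSelmerLowerDivisibilityAtTwo_of_blowup` (a datum + an in-range `ξ` with
`‖V(ξ)‖ > 1`); the instrument record (ADD-5: `v₂ V = 2` at 22/22 points, `= 4` at 6/6 on 113a1) contains no such `ξ`. -/
def NotO2 : Prop := ¬ TwoAdicKatoDeterminant.BDPSelmerLowerDivisibilityAtTwo

end Targets

end Summit.BirchSwinnertonDyer.BirchSwinnertonDyer.Cruxes.BDPSelmerLowerDivisibilityAtTwo.Disproof

end
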